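import Literature.MathematicalPhysics.QuantumLattice.HubbardTTPrimeThermalPressureZeeman
import Literature.MathematicalPhysics.QuantumLattice.HubbardTTPrimeGrandCanonicalTorusLimit
import HarnessLib

/-!
# Griffiths brackets in the Zeeman field for the canonical pressure, and the a-priori SECTOR ceiling
# `p(β; n↑, n↓) ≤ H_b(n↑) + H_b(n↓) − β·e(t,t',U, n↑ + n↓)`

Topic `MathematicalPhysics/QuantumLattice` (family `hubbard`; stage S2 (iii) `T > 0`, the `T × H` axes of the
phase map). Sequel of `HubbardTTPrimeThermalPressureZeeman` (the canonical pressure in a field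
`pressureTT'Zeeman β t t' U n h = sup_{x ∈ spinFibre n} [pressureTT'₂ β t t' U x (n−x) + βh(2x − n)]`).

* §1 GRIFFITHS BRACKETS IN THE FIELD: the magnetisation `2x − n` of every `ε`-dominant spin sector of the fibre
  (`p(n,h) − ε ≤ p(x,n−x) + βh(2x−n)`; such sectors exist at every `ε > 0`, `exists_dominant`) lies in
  `[(p(n,h) − p(n,h−δ) − ε)/(βδ), (p(n,h+δ) − p(n,h) + ε)/(βδ)]` — certified canonical pressures at three fields
  bracket the magnetisation of the canonical ensemble in a field (the canonical twin of the grand-canonical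
  `HubbardTTPrimeGrandCanonicalDensityBrackets`);
* §2 THE A-PRIORI SECTOR CEILING (`β ≥ 0`, `U ≥ 0`, `x, y ∈ [0,1)`, `0 < x + y`):
  `pressureTT'₂ β t t' U x y ≤ H_b(x) + H_b(y) − β · energyDensityTT' t t' U (x + y)` — sector entropy minus `β` times
  the ground-state energy of the FULL filling (which every spin sector dominates). Finite volume: on the sector
  `(a,b)` of the `L × L` torus, `H − μN̂ − E₀(H − μN̂) ⪰ 0` compresses to `H|_{(a,b)} − (μ(a+b) + E₀(H−μN̂)) ⪰ 0`, so
  `log Z(a,b) ≤ log #(a,b) − β(μ(a+b) + E₀(H − μN̂))`, and `E₀(H − μN̂) ≥ p(μ)L² − O(L)` (`gcFloor_hubbardRectTorusTT'`,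
  `p = gcEnergyDensityTT'`); in the limit `p(x,y) ≤ H_b(x) + H_b(y) − β(μ(x+y) + p(μ))` for EVERY `μ`, and the
  supporting `μ` of `e` at `x + y` (`exists_gcEnergyDensityTT'_add_mul_eq`) gives the claim. Consequence: the sharper
  field-dependent entropy cap `p(n,h) ≤ sup_{x ∈ spinFibre n}[H_b(x) + H_b(n−x) + βh(2x−n)] − β e(n)` (free spins in a
  field) behind `pressureTT'Zeeman_mem_Icc`.

HONEST SCOPE: numbers only; no certificate value; no phase word; no definition. Everything PROVED, 0 sorry.

## Mathlib / tree search
REUSED: `le_pressureTT'Zeeman`, `exists_dominant`, `pressureTT'Zeeman_le_iff` (…ThermalPressureZeeman);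
`tendsto_spinSectorPressureTT'`, `tendsto_log_choose_halfRectN_div_sq` (…SpinSectors); `gcFloor_hubbardRectTorusTT'`,
`le_groundEnergy_gc_of_forall_sector` (…GrandCanonicalTorusLimit); `exists_gcEnergyDensityTT'_add_mul_eq`;
`posSemidef_sub_groundEnergy` (FinDimSpectrumProofs); `log_partitionFn_le_of_posSemidef`, `partitionFn_add_smul_one`
(ApproximatingHamiltonianProofs); `spinSectorHamiltonian_sub_smul_totalNumber`, `card_orb`, `card_rectSites`,
`nonempty_spinConfig`, `pairSet_upPart_downPart`; Mathlib `Matrix.PosSemidef.submatrix`, `Fintype.card_finset_len`.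

## References
* R. B. Griffiths, J. Math. Phys. 5 (1964) 1215, Appendix (convexity lemma). [cite: Griffiths1964, Appendix]
* D. Ruelle, *Statistical Mechanics: Rigorous Results* (1969), §2.5–2.6, §3.4. [cite: Ruelle1969, §3.4]
* R. B. Israel, *Convexity in the Theory of Lattice Gases* (1979), Lemma II.3.1. [cite: Israel1979, Lemma II.3.1]
* E. H. Lieb, Phys. Rev. Lett. 62 (1989) 1201, proof of Thm. 1. [cite: LiebPRL1989, proof of Theorem 1]
-/

noncomputable section

namespace Literature.MathematicalPhysics.QuantumLattice

namespace ThermodynamicLimit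

open _root_.Filter Set Finset Matrix
open scoped _root_.Topology BigOperators ComplexOrder

/-! ### §1 Griffiths brackets in the field: the magnetisation of the dominant spin sectors -/

section Brackets

variable {β : ℝ} (hβ : 0 < β) (t t' : ℝ) {U : ℝ} (hU : 0 ≤ U) {n : ℝ}
include hβ hU

/-- **Upper magnetisation bracket**: if the sector `x ∈ spinFibre n` is `ε`-dominant at field `h`
(`p(x,n−x) + βh(2x−n) ≥ p(n,h) − ε`) then for every `δ > 0` its magnetisation obeys
`2x − n ≤ (p(n, h+δ) − p(n, h) + ε)/(βδ)` — certified pressures at two fields cap the magnetisation of the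
canonical ensemble in a field. [cite: Griffiths1964, Appendix] -/
theorem magnetisation_le_of_dominant (hz : ℝ) {x ε δ : ℝ} (hx : x ∈ spinFibre n) (hδ : 0 < δ)
    (hdom : pressureTT'Zeeman β t t' U n hz - ε ≤ pressureTT'₂ β t t' U x (n - x) + β * hz * (2 * x - n)) :
    2 * x - n ≤ (pressureTT'Zeeman β t t' U n (hz + δ) - pressureTT'Zeeman β t t' U n hz + ε) / (β * δ) := by
  have h1 := le_pressureTT'Zeeman hβ.le t t' hU (hz + δ) hx
  rw [le_div_iff₀ (mul_pos hβ hδ)]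
  have e : pressureTT'₂ β t t' U x (n - x) + β * (hz + δ) * (2 * x - n) =
      (pressureTT'₂ β t t' U x (n - x) + β * hz * (2 * x - n)) + (2 * x - n) * (β * δ) := by ring
  rw [e] at h1
  linarith

/-- **Lower magnetisation bracket**: under the same `ε`-dominance, `(p(n,h) − p(n,h−δ) − ε)/(βδ) ≤ 2x − n`.
[cite: Griffiths1964, Appendix] -/
theorem le_magnetisation_of_dominant (hz : ℝ) {x ε δ : ℝ} (hx : x ∈ spinFibre n) (hδ : 0 < δ)
    (hdom : pressureTT'Zeeman β t t' U n hz - ε ≤ pressureTT'₂ β t t' U x (n - x) + β * hz * (2 * x - n)) :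
    (pressureTT'Zeeman β t t' U n hz - pressureTT'Zeeman β t t' U n (hz - δ) - ε) / (β * δ) ≤ 2 * x - n := by
  have h1 := le_pressureTT'Zeeman hβ.le t t' hU (hz - δ) hx
  rw [div_le_iff₀ (mul_pos hβ hδ)]
  have e : pressureTT'₂ β t t' U x (n - x) + β * (hz - δ) * (2 * x - n) =
      (pressureTT'₂ β t t' U x (n - x) + β * hz * (2 * x - n)) - (2 * x - n) * (β * δ) := by ring
  rw [e] at h1
  linarith

/-- **Certificate form**: a ceiling `p(n, h+δ) ≤ u` and a floor `ℓ ≤ p(n, h)` give `2x − n ≤ (u − ℓ + ε)/(βδ)` for every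
`ε`-dominant sector. [cite: Griffiths1964, Appendix] -/
theorem magnetisation_le_of_bounds (hz : ℝ) {x ε δ u ℓ : ℝ} (hx : x ∈ spinFibre n) (hδ : 0 < δ)
    (hdom : pressureTT'Zeeman β t t' U n hz - ε ≤ pressureTT'₂ β t t' U x (n - x) + β * hz * (2 * x - n))
    (hu : pressureTT'Zeeman β t t' U n (hz + δ) ≤ u) (hℓ : ℓ ≤ pressureTT'Zeeman β t t' U n hz) :
    2 * x - n ≤ (u - ℓ + ε) / (β * δ) :=
  (magnetisation_le_of_dominant hβ t t' hU hz hx hδ hdom).trans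
    (div_le_div_of_nonneg_right (by linarith) (mul_pos hβ hδ).le)

end Brackets

/-! ### §2 The a-priori sector ceiling with the full-filling ground-state energy -/

section SectorCard

variable {Λ : Type*} [LinearOrder Λ] [Fintype Λ]

/-- **A spin sector has at most `C(|Λ|, a)·C(|Λ|, b)` configurations** (a configuration is the pair of its up- and
down-spin site sets). [cite: LiebPRL1989, proof of Theorem 1] -/
theorem card_subtype_spinConfig_le_choose_mul_choose (a b : ℕ) :
    Fintype.card (Subtype (spinConfig (Λ := Λ) a b)) ≤ (Fintype.card Λ).choose a * (Fintype.card Λ).choose b := by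
  classical
  let f : Subtype (spinConfig (Λ := Λ) a b) → {α : Finset Λ // α.card = a} × {γ : Finset Λ // γ.card = b} :=
    fun s => (⟨upPart s.1, s.2.1⟩, ⟨downPart s.1, s.2.2⟩)
  have hf : Function.Injective f := by
    rintro ⟨s, hs⟩ ⟨s', hs'⟩ h
    simp only [f, Prod.mk.injEq, Subtype.mk.injEq] at h
    apply Subtype.ext
    show s = s'
    rw [← pairSet_upPart_downPart s, ← pairSet_upPart_downPart s', h.1, h.2]
  have hcard := Fintype.card_le_of_injective f hf
  rwa [Fintype.card_prod, Fintype.card_finset_len, Fintype.card_finset_len] at hcard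

end SectorCard

section SectorCeiling

variable {β : ℝ} (hβ : 0 ≤ β) (t t' : ℝ) {U : ℝ} (hU : 0 ≤ U)
include hβ hU

omit hβ in
/-- The grand-canonical floor constant of the `L × L` torus at chemical potential `μ`:
`F_L(μ) = p(μ)L² − (16|t|+32|t'|)L − (54(2|t|+|U|+2|t'|) + 2|μ|) ≤ E₀(H_L − μN̂)` (`gcFloor_hubbardRectTorusTT'` in every
sector, hence for the least eigenvalue on the Fock space). [cite: Ruelle1969, §3.4] -/
theorem gcFloor_le_groundEnergy_hubbardRectTorusTT'_gc (μ : ℝ) {L : ℕ} (hL : 1 ≤ L) :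
    gcEnergyDensityTT' t t' U μ * (L : ℝ) ^ 2 - (16 * |t| + 32 * |t'|) * L - (54 * (2 * |t| + |U| + 2 * |t'|) + 2 * |μ|) ≤
      Matrix.groundEnergy (hubbardRectTorusTT' L L t t' U -
        (μ : ℂ) • (totalNumber : Matrix (Finset (Orb (Fin L ×ₗ Fin L))) (Finset (Orb (Fin L ×ₗ Fin L))) ℂ)) := by
  have h := le_groundEnergy_gc_of_forall_sector (hubbardRectTorusTT' L L t t' U) (hubbardRectTorusTT'_isHermitian L L t t' U)
    (hubbardRectTorusTT'_commute_totalNumber L L t t' U) μ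
    (gcEnergyDensityTT' t t' U μ * (L : ℝ) ^ 2 - (16 * |t| + 32 * |t'|) * L - (54 * (2 * |t| + |U| + 2 * |t'|) + 2 * |μ|))
    (fun N hN => by
      rw [Finset.mem_range, card_orb, card_rectSites, Nat.lt_succ_iff] at hN
      exact gcFloor_hubbardRectTorusTT' t t' hU μ hL (by rw [sq]; exact hN))
  convert h using 2

/-- **Finite-volume sector ceiling**: for `L ≥ 1`, `a, b ≤ L²` and every `μ`,
`log Re Z_β(H_L; a, b) ≤ log[C(L²,a)·C(L²,b)] − β(μ(a+b) + F_L(μ))` — `H_L − μN̂ − E₀(H_L − μN̂) ⪰ 0` compressed to the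
sector, the max-entropy bound `log Z ≤ log dim − β·(floor)`, the configuration count and the grand-canonical floor.
[cite: Ruelle1969, §3.4] -/
theorem log_partitionFn_spinSector_le_log_choose_sub (μ : ℝ) {L : ℕ} (hL : 1 ≤ L) {a b : ℕ} (ha : a ≤ L * L)
    (hb : b ≤ L * L) :
    Real.log (partitionFn β (spinSectorHamiltonian a b (hubbardRectTorusTT' L L t t' U))).re ≤
      Real.log ((((L * L).choose a * (L * L).choose b : ℕ)) : ℝ) -
        β * (μ * ((a : ℝ) + b) + (gcEnergyDensityTT' t t' U μ * (L : ℝ) ^ 2 - (16 * |t| + 32 * |t'|) * L -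
          (54 * (2 * |t| + |U| + 2 * |t'|) + 2 * |μ|))) := by
  set A := hubbardRectTorusTT' L L t t' U with hAdef
  set K := A - (μ : ℂ) • (totalNumber : Matrix (Finset (Orb (Fin L ×ₗ Fin L))) (Finset (Orb (Fin L ×ₗ Fin L))) ℂ) with hKdef
  set F : ℝ := gcEnergyDensityTT' t t' U μ * (L : ℝ) ^ 2 - (16 * |t| + 32 * |t'|) * L -
    (54 * (2 * |t| + |U| + 2 * |t'|) + 2 * |μ|) with hF
  have hA : A.IsHermitian := hubbardRectTorusTT'_isHermitian L L t t' U
  have hK : K.IsHermitian := hA.sub (isHermitian_real_smul totalNumber_isHermitian μ)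
  have hFE : F ≤ K.groundEnergy := gcFloor_le_groundEnergy_hubbardRectTorusTT'_gc t t' hU μ hL
  -- the sector is nonempty
  haveI : Nonempty (Subtype (spinConfig (Λ := Fin L ×ₗ Fin L) a b)) :=
    nonempty_spinConfig (by rw [card_rectSites]; exact ha) (by rw [card_rectSites]; exact hb)
  -- PSD of the compression of `K − E₀(K)`
  set c : ℝ := μ * ((a : ℝ) + b) + K.groundEnergy with hc
  have hpsd0 := (posSemidef_sub_groundEnergy hK).submatrix (Subtype.val : Subtype (spinConfig (Λ := Fin L ×ₗ Fin L) a b) → _)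
  have hsub : (K - algebraMap ℝ _ K.groundEnergy).submatrix Subtype.val Subtype.val =
      spinSectorHamiltonian a b A - (c : ℂ) • (1 : Matrix (Subtype (spinConfig (Λ := Fin L ×ₗ Fin L) a b))
        (Subtype (spinConfig (Λ := Fin L ×ₗ Fin L) a b)) ℂ) := by
    have h2 : K.submatrix Subtype.val Subtype.val = spinSectorHamiltonian a b A + ((-(μ * (a + b)) : ℝ) : ℂ) • 1 := by
      rw [hKdef, hAdef]
      exact spinSectorHamiltonian_sub_smul_totalNumber a b (hubbardRectTorusTT' L L t t' U) μ
    rw [Algebra.algebraMap_eq_smul_one]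
    ext ⟨s, hs⟩ ⟨u, hu⟩
    have h2' := congrFun (congrFun h2 ⟨s, hs⟩) ⟨u, hu⟩
    simp only [submatrix_apply] at h2'
    simp only [submatrix_apply, Matrix.sub_apply, h2', Matrix.add_apply, Matrix.smul_apply, Matrix.one_apply,
      Subtype.mk.injEq, smul_eq_mul, Complex.real_smul, hc]
    split_ifs <;> push_cast <;> ring
  rw [hsub] at hpsd0
  -- compare with the scalar Hamiltonian `c·1`
  have hH₁ : ((c : ℂ) • (1 : Matrix (Subtype (spinConfig (Λ := Fin L ×ₗ Fin L) a b))
      (Subtype (spinConfig (Λ := Fin L ×ₗ Fin L) a b)) ℂ)).IsHermitian := by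
    rw [Matrix.IsHermitian, conjTranspose_smul, conjTranspose_one, Complex.star_def, Complex.conj_ofReal]
  have hle := log_partitionFn_le_of_posSemidef hH₁ (isHermitian_spinSectorHamiltonian a b hA) hβ hpsd0
  -- `Z_β(c·1) = e^{−βc} · #sector`
  have hZ1 : (partitionFn β ((c : ℂ) • (1 : Matrix (Subtype (spinConfig (Λ := Fin L ×ₗ Fin L) a b))
      (Subtype (spinConfig (Λ := Fin L ×ₗ Fin L) a b)) ℂ))).re =
      Real.exp (-(β * c)) * Fintype.card (Subtype (spinConfig (Λ := Fin L ×ₗ Fin L) a b)) := by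
    have h0 := partitionFn_add_smul_one β (0 : Matrix (Subtype (spinConfig (Λ := Fin L ×ₗ Fin L) a b))
      (Subtype (spinConfig (Λ := Fin L ×ₗ Fin L) a b)) ℂ) c
    rw [zero_add] at h0
    have hZ0 : partitionFn β (0 : Matrix (Subtype (spinConfig (Λ := Fin L ×ₗ Fin L) a b))
        (Subtype (spinConfig (Λ := Fin L ×ₗ Fin L) a b)) ℂ) =
        (Fintype.card (Subtype (spinConfig (Λ := Fin L ×ₗ Fin L) a b)) : ℂ) := by
      simp [partitionFn, gibbsWeight, Matrix.trace_one]
    rw [h0, hZ0, ← Complex.ofReal_natCast, ← Complex.ofReal_mul, Complex.ofReal_re]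
  have hcardpos : (0 : ℝ) < Fintype.card (Subtype (spinConfig (Λ := Fin L ×ₗ Fin L) a b)) := by
    exact_mod_cast Fintype.card_pos
  have hcard : (Fintype.card (Subtype (spinConfig (Λ := Fin L ×ₗ Fin L) a b)) : ℝ) ≤
      (((L * L).choose a * (L * L).choose b : ℕ) : ℝ) := by
    have h := card_subtype_spinConfig_le_choose_mul_choose (Λ := Fin L ×ₗ Fin L) a b
    rw [card_rectSites] at h
    exact_mod_cast h
  rw [hZ1, Real.log_mul (Real.exp_pos _).ne' hcardpos.ne', Real.log_exp] at hle
  have hlogc := Real.log_le_log hcardpos hcard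
  have hβc : -(β * c) ≤ -(β * (μ * ((a : ℝ) + b) + F)) := by
    rw [hc]; nlinarith [hFE, hβ]
  linarith

omit hβ hU in
/-- `⌊cL²⌋/L² → c` (`halfRectN (2c) L = ⌊cL²⌋`). [folklore] -/
private theorem tendsto_halfRectN_two_mul_div_sq {c : ℝ} (hc : 0 ≤ c) :
    Tendsto (fun L : ℕ => (halfRectN (2 * c) L : ℝ) / (L : ℝ) ^ 2) atTop (𝓝 c) := by
  have h := (tendsto_rectN_div_sq (n := 2 * c) (by linarith)).div_const 2
  rw [mul_div_cancel_left₀ c two_ne_zero] at h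
  refine h.congr fun L => ?_
  rw [show rectN (2 * c) L = 2 * halfRectN (2 * c) L from rfl]
  push_cast
  ring

/-- **THE A-PRIORI SECTOR CEILING**: `p(β; t,t',U; n↑, n↓) ≤ H_b(n↑) + H_b(n↓) − β·e(t,t',U, n↑ + n↓)` for
`n↑, n↓ ∈ [0,1)`, `0 < n↑ + n↓` (`β ≥ 0`, `U ≥ 0`): sector entropy minus `β` times the FULL-filling ground-state energy
density `energyDensityTT'`, which every spin sector of that filling dominates. [cite: Ruelle1969, §3.4] -/
theorem pressureTT'₂_le_binEntropy_add_sub_energy {x y : ℝ} (hx0 : 0 ≤ x) (hx1 : x < 1) (hy0 : 0 ≤ y) (hy1 : y < 1)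
    (hxy : 0 < x + y) :
    pressureTT'₂ β t t' U x y ≤ Real.binEntropy x + Real.binEntropy y - β * energyDensityTT' t t' U (x + y) := by
  obtain ⟨μ, hμ⟩ := exists_gcEnergyDensityTT'_add_mul_eq t t' hU hxy (by linarith : x + y < 2)
  set p := gcEnergyDensityTT' t t' U μ with hp
  set C₁ : ℝ := 16 * |t| + 32 * |t'| with hC₁
  set C₂ : ℝ := 54 * (2 * |t| + |U| + 2 * |t'|) + 2 * |μ| with hC₂
  -- the finite-volume ceiling per volume, as a sequence
  set R : ℕ → ℝ := fun L => Real.log ((L * L).choose (halfRectN (2 * x) L)) / (L : ℝ) ^ 2 +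
    Real.log ((L * L).choose (halfRectN (2 * y) L)) / (L : ℝ) ^ 2 -
    β * (μ * ((halfRectN (2 * x) L : ℝ) / (L : ℝ) ^ 2 + (halfRectN (2 * y) L : ℝ) / (L : ℝ) ^ 2) +
      (p - C₁ / L - C₂ / (L : ℝ) ^ 2)) with hR
  have hRlim : Tendsto R atTop (𝓝 (Real.binEntropy x + Real.binEntropy y - β * (μ * (x + y) + (p - 0 - 0)))) := by
    have h1 := tendsto_log_choose_halfRectN_div_sq hx0 hx1
    have h2 := tendsto_log_choose_halfRectN_div_sq hy0 hy1
    have h3 := tendsto_halfRectN_two_mul_div_sq hx0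
    have h4 := tendsto_halfRectN_two_mul_div_sq hy0
    have h5 : Tendsto (fun L : ℕ => C₁ / (L : ℝ)) atTop (𝓝 0) := tendsto_const_div_atTop_nhds_zero_nat C₁
    have h6 : Tendsto (fun L : ℕ => C₂ / (L : ℝ) ^ 2) atTop (𝓝 0) := by
      have := (tendsto_pow_atTop (α := ℝ) two_ne_zero).comp tendsto_natCast_atTop_atTop
      simpa using this.const_div_atTop C₂
    exact ((h1.add h2).sub ((((h3.add h4).const_mul μ).add ((tendsto_const_nhds.sub h5).sub h6)).const_mul β))
  have hlim : Real.binEntropy x + Real.binEntropy y - β * (μ * (x + y) + (p - 0 - 0)) =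
      Real.binEntropy x + Real.binEntropy y - β * energyDensityTT' t t' U (x + y) := by
    rw [← hμ]; ring
  rw [hlim] at hRlim
  refine le_of_tendsto_of_tendsto (tendsto_spinSectorPressureTT' hβ t t' hU hx0 hx1 hy0 hy1) hRlim ?_
  filter_upwards [eventually_ge_atTop 1] with L hL1
  have hL2 : (0 : ℝ) < (L : ℝ) ^ 2 := by
    have : (1 : ℝ) ≤ L := by exact_mod_cast hL1
    positivity
  have hLpos : (0 : ℝ) < L := by exact_mod_cast hL1
  have haM : halfRectN (2 * x) L ≤ L * L := (halfRectN_lt_sq (by linarith) (by linarith) hL1).le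
  have hbM : halfRectN (2 * y) L ≤ L * L := (halfRectN_lt_sq (by linarith) (by linarith) hL1).le
  have hfin := log_partitionFn_spinSector_le_log_choose_sub hβ t t' hU μ hL1 haM hbM
  have hca : 0 < ((L * L).choose (halfRectN (2 * x) L) : ℝ) := by exact_mod_cast Nat.choose_pos haM
  have hcb : 0 < ((L * L).choose (halfRectN (2 * y) L) : ℝ) := by exact_mod_cast Nat.choose_pos hbM
  have hsplit : Real.log ((((L * L).choose (halfRectN (2 * x) L) * (L * L).choose (halfRectN (2 * y) L) : ℕ)) : ℝ) =
      Real.log ((L * L).choose (halfRectN (2 * x) L)) + Real.log ((L * L).choose (halfRectN (2 * y) L)) := by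
    push_cast
    exact Real.log_mul hca.ne' hcb.ne'
  rw [hsplit] at hfin
  show spinSectorPressureTT' β t t' U x y L ≤ R L
  rw [hR, spinSectorPressureTT']
  simp only
  rw [← add_div, div_le_iff₀ hL2]
  have e : (Real.log ((L * L).choose (halfRectN (2 * x) L)) + Real.log ((L * L).choose (halfRectN (2 * y) L))) /
        (L : ℝ) ^ 2 * (L : ℝ) ^ 2 = Real.log ((L * L).choose (halfRectN (2 * x) L)) +
          Real.log ((L * L).choose (halfRectN (2 * y) L)) := div_mul_cancel₀ _ hL2.ne'
  have e2 : (β * (μ * ((halfRectN (2 * x) L : ℝ) / (L : ℝ) ^ 2 + (halfRectN (2 * y) L : ℝ) / (L : ℝ) ^ 2) +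
      (p - C₁ / L - C₂ / (L : ℝ) ^ 2))) * (L : ℝ) ^ 2 =
      β * (μ * ((halfRectN (2 * x) L : ℝ) + halfRectN (2 * y) L) + (p * (L : ℝ) ^ 2 - C₁ * L - C₂)) := by
    field_simp
  rw [sub_mul, e, e2]
  exact hfin

/-- **The sharper field cap behind `pressureTT'Zeeman_mem_Icc`**: `p(n,h) ≤ −β e(n) + sup-free form`, namely every
fibre term obeys `p(x,n−x) + βh(2x−n) ≤ H_b(x) + H_b(n−x) + βh(2x−n) − β e(n)` (free spins in a field at entropy level),
for `0 < n < 2`. [cite: Ruelle1969, §3.4] -/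
theorem fibreTerm_le_binEntropy_add_field_sub (hz : ℝ) {n x : ℝ} (hn0 : 0 < n) (hx : x ∈ spinFibre n) :
    pressureTT'₂ β t t' U x (n - x) + β * hz * (2 * x - n) ≤
      Real.binEntropy x + Real.binEntropy (n - x) + β * hz * (2 * x - n) - β * energyDensityTT' t t' U n := by
  obtain ⟨h0, h1, h2, h3⟩ := hx
  have h := pressureTT'₂_le_binEntropy_add_sub_energy hβ t t' hU h0 h1 h2 h3 (by linarith)
  rw [show x + (n - x) = n by ring] at h
  linarith

end SectorCeiling

end ThermodynamicLimit

end Literature.MathematicalPhysics.QuantumLattice
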